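import Summits.QuantumAdvantage.QuantumAdvantage.Theorems.CubicForrelationNearExactIsExactTwelvePartnerR2Blocks
import Summits.QuantumAdvantage.QuantumAdvantage.Theorems.CubicForrelationNearExactIsExactTwelvePartnerLeaves

/-!
# Crux `CubicForrelation.NearExactIsExact` (stmt-QuantumAdvantage-14043) — n = 12, E1280-even, R2 leaf s₀ω₄(b) ASSEMBLED
  (E1280-HANDPROOFS.md §1.6): frame data + light structure + pairing partner ⇒ contradiction

Certificate seat `b2b-cforr-cert` (gen 39).  HONEST FRAMING: kernel-checked (standard axioms) end-to-end version of the leaf s₀ω₄(b) in the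
coefficient-tensor language, on the pattern of …TwelvePartnerR2LeafTb: descendant `t̄ = s₀ω₄` has no monomial through `F′ = {s₅..s₈}`
(`htb`), and in sub-case (b) the light structure is `G = D + s₀∧g`, `Γ = D′ + s₀∧γ` with `D, D′` supported on `P × P` — so the F′-rows of
`G` and `Γ` are single outer products `g νᵀ`, `γ μᵀ` (hypotheses `hG`, `hΓ`, slightly more general).  (E3) of …TwelvePartnerR2Blocks on
`F′ × F′` is then `g αᵀ + γ βᵀ = 1₄`, impossible by `tpl_R2_w4b_core`.  NOT summit progress.
-/

set_option linter.dupNamespace false -- D-0017: single-problem summit ⇒ `QuantumAdvantage.QuantumAdvantage` by design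

namespace Summit.QuantumAdvantage.QuantumAdvantage.Theorems.CubicForrelation.NearExactIsExact

open Finset Matrix

/-- **R2 leaf s₀ω₄(b), assembled.**  Inside `Fin 9 = Fin (5 + 4)`: `Fin.natAdd 5 f` = `F′ = {s₅..s₈}`. [this work] -/
theorem tpa_R2_w4b (c d : Fin (3 + 9) → Fin (3 + 9) → Fin (3 + 9) → ZMod 2)
    (hcs : ∀ p j k, c p k j = c p j k) (hcc : ∀ p j k, c j p k = c p j k)
    (hds : ∀ φ j k, d φ k j = d φ j k) (hdc : ∀ φ j k, d j φ k = d φ j k) (hdd : ∀ φ j, d φ j j = 0)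
    (hpair : ∀ p φ, (∑ j, ∑ k, (if j < k then c p j k * d φ j k else 0)) = if p = φ then 1 else 0)
    (hF1 : ∀ j k, d (Fin.castAdd 9 0) j k =
      if (j = Fin.castAdd 9 1 ∧ k = Fin.castAdd 9 2) ∨ (j = Fin.castAdd 9 2 ∧ k = Fin.castAdd 9 1) then 1 else 0)
    (htb : ∀ (f : Fin 4) (s t : Fin (5 + 4)),
      d (Fin.natAdd 3 (Fin.natAdd 5 f)) (Fin.natAdd 3 s) (Fin.natAdd 3 t) = 0)
    (g γ : Fin 4 → ZMod 2) (ν μ : Fin (5 + 4) → ZMod 2)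
    (hG : ∀ (f : Fin 4) (s : Fin (5 + 4)), d (Fin.castAdd 9 1) (Fin.natAdd 3 (Fin.natAdd 5 f)) (Fin.natAdd 3 s) = g f * ν s)
    (hΓ : ∀ (f : Fin 4) (s : Fin (5 + 4)), d (Fin.castAdd 9 2) (Fin.natAdd 3 (Fin.natAdd 5 f)) (Fin.natAdd 3 s) = γ f * μ s) :
    False := by
  have hE3 := tpb_E3 c d hcs hcc hds hdc hdd hpair hF1
  set α : Fin 4 → ZMod 2 := fun x => ∑ s, ν s * c (Fin.castAdd 9 1) (Fin.natAdd 3 s) (Fin.natAdd 3 (Fin.natAdd 5 x)) with hα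
  set β : Fin 4 → ZMod 2 := fun x => ∑ s, μ s * c (Fin.castAdd 9 2) (Fin.natAdd 3 s) (Fin.natAdd 3 (Fin.natAdd 5 x)) with hβ
  have hiffF : ∀ r x : Fin 4, ((Fin.natAdd 5 r : Fin (5 + 4)) = Fin.natAdd 5 x) ↔ r = x := fun r x => by
    constructor
    · intro h'; have := congrArg Fin.val h'; simp only [Fin.val_natAdd] at this; exact Fin.ext (by omega)
    · rintro rfl; rfl
  refine tpl_R2_w4b_core g γ α β fun r x => ?_
  have h := hE3 (Fin.natAdd 5 r) (Fin.natAdd 5 x)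
  have hτ : (∑ s, ∑ t, (if s < t then c (Fin.natAdd 3 (Fin.natAdd 5 x)) (Fin.natAdd 3 s) (Fin.natAdd 3 t) *
      d (Fin.natAdd 3 (Fin.natAdd 5 r)) (Fin.natAdd 3 s) (Fin.natAdd 3 t) else 0)) = 0 :=
    Finset.sum_eq_zero fun s _ => Finset.sum_eq_zero fun t _ => by rw [htb, mul_zero, ite_self]
  rw [hτ, add_zero] at h
  rw [show (if (Fin.natAdd 5 r : Fin (5 + 4)) = Fin.natAdd 5 x then (1 : ZMod 2) else 0) = if r = x then 1 else 0 from by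
    by_cases hrx : r = x
    · rw [if_pos ((hiffF r x).2 hrx), if_pos hrx]
    · rw [if_neg (fun h' => hrx ((hiffF r x).1 h')), if_neg hrx]] at h
  rw [← h, hα, hβ]
  simp only [Finset.mul_sum, ← Finset.sum_add_distrib]
  refine Finset.sum_congr rfl fun s _ => ?_
  rw [hG, hΓ]
  ring

end Summit.QuantumAdvantage.QuantumAdvantage.Theorems.CubicForrelation.NearExactIsExact
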